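import Summits.Ventures.LatticeQCDFlow.TrivializingMaps.UNHaarTraceMoments

/-!
HONEST FRAMING: exact (Metropolis-corrected) sampling algorithms for lattice gauge theory; figures
of merit are autocorrelation/cost numbers at stated couplings and volumes; no continuum-physics
claim.

# UNWilsonFisherZero — EVERY FINITE-VOLUME `U(N)` WILSON PARTITION FUNCTION HAS A FISHER ZERO WITH
# `|s₀| ≤ 8N`; THE ZEROS ARE EXTENSIVE; SPECIFIC HEAT `½ + O(x)` PER PLAQUETTE UNIFORMLY IN THE VOLUME;
# ONE STRONG-COUPLING REWEIGHTING STEP HAS `E[w²] ≥ exp(δ²·#plaq/4)` (lean-2 GEN-9, ours)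

Venture-side (OURS).  Cell `lqcd-flow` (pub-lqcd), unit `pub-lqcd-lean-2-g9`, 2026-08-22.  The `U(N)`
(`N ≥ 1`, defining representation `unitaryFundamentalRep`, `S_W = ∑_p (N − Re tr U_p)`) instances of
the every-compact-group theorems of GEN-8, fed by `UNHaarTraceMoments.un_variance_re_trace`
(`Var_Haar(Re tr) = ½` on `U(N)`), every `d ≥ 2` (where stated), EVERY `L ≥ 2`:

* **`un_variance_wilsonAction`** — `Var_{D[U]}(S_W) = #plaquettes/2` (`PlaquetteDecorrelation`);
* **`un_wilsonZ_exists_zero_norm_le`** — a zero `s₀` of `Z_L(s) = ∫ D[U] e^{-sS_W}` with `|s₀| ≤ 8N`, a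
  VOLUME-INDEPENDENT disc (`8` for `U(1)`, as in the tree's `U1WilsonFisherZero`; `SU(2)`: `8`,
  `SU(n ≥ 3)`: `8n`); `un_wilsonZ_integral_exists_zero_norm_le` in Lüscher's notation;
* **`un_wilsonZ_fisherZeros_extensive`** — with `r = 1/(8e·N·(3^d d²+1)²)`, every `R > 0`: zeros `u` with
  `r ≤ |u| < R` of total multiplicity `≥ r²·(½ − 4N/R)·#plaquettes` (`WilsonFisherZerosAnyGroup`);
* **`un_variance_sub_le`** — `|Var_x(S_W) − #plaq/2| ≤ 256·#plaq·|x|/r³` for real `|x| < r/4`: the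
  specific heat per plaquette is `½ + O(|x|)` uniformly in `L` (`SpecificHeatAnyGroup`);
* **`un_weight_sq_ge_exp`** — one exact reweighting step `β → β+δ` with `[β, β+2δ]` in the window
  `|x| ≤ min (r/8) (r³/1024)` has importance-weight second moment `≥ exp(δ²·#plaq/4)`: at fixed
  per-step weight variance the number of steps grows linearly with the volume (`AnnealingAnyGroup`).

NOT CLAIMED: `L = 1`; anything outside the (astronomically small) Kotecký–Preiss window for the `β ≠ 0`
items; sharpness of `8N`; cost / autocorrelation / continuum statements.  Literature grade (cell
rule): known mechanisms, new typing only, no new theorem of physics.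
-/

open MeasureTheory ProbabilityTheory Filter Topology Complex Set Metric MeromorphicOn
open Literature.MathematicalPhysics.QuantumFieldTheory
open Literature.MathematicalPhysics.QuantumFieldTheory.Luscher2010
open Literature.MathematicalPhysics.QuantumLattice (unitaryFundamentalRep unitaryFundamentalRep_apply
  continuous_unitaryFundamentalRep)

namespace Summit.Ventures.LatticeQCDFlow.TrivializingMaps

/-! ## §2 The `U(N)` Wilson theory: Fisher zero `|s₀| ≤ 8N`, extensive zeros, specific heat `½`,
the strong-coupling reweighting law -/

section Wilson

variable {d L N : ℕ} [NeZero L]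

/-- **`Var_{D[U]}(S_W^{U(N)}) = #plaquettes / 2`** (`N ≥ 1`, every `d`, every `L ≥ 2`). [ours] -/
theorem un_variance_wilsonAction (hN : 1 ≤ N) (hL : 2 ≤ L) :
    variance (wilsonAction (d := d) (L := L) (unitaryFundamentalRep (Fin N) ℂ))
        (trivialMeasure (Matrix.unitaryGroup (Fin N) ℂ) d L) =
      Fintype.card (Plaquette d L) / 2 := by
  haveI := unitaryGroup_secondCountableTopology (N := N)
  rw [variance_wilsonAction_eq_card_mul (unitaryFundamentalRep (Fin N) ℂ)
    (continuous_unitaryFundamentalRep (Fin N) ℂ) hL, un_variance_re_trace hN]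
  ring

/-- **EVERY FINITE-VOLUME `U(N)` WILSON PARTITION FUNCTION HAS A FISHER ZERO WITH `|s₀| ≤ 8N`**
(`N ≥ 1`, `d ≥ 2`, every `L ≥ 2`): `Z_L(s₀) = ∫ D[U] e^{-s₀ S_W} = 0`, a volume-independent disc. [ours] -/
theorem un_wilsonZ_exists_zero_norm_le (hN : 1 ≤ N) (hd : 2 ≤ d) (hL : 2 ≤ L) :
    ∃ s₀ : ℂ, ‖s₀‖ ≤ 8 * N ∧
      complexMGF (fun U => -wilsonAction (unitaryFundamentalRep (Fin N) ℂ) U)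
        (trivialMeasure (Matrix.unitaryGroup (Fin N) ℂ) d L) s₀ = 0 := by
  haveI := unitaryGroup_secondCountableTopology (N := N)
  obtain ⟨s₀, hs₀, hz⟩ := wilsonZ_exists_zero_norm_le_uniform (d := d) (L := L)
    (unitaryFundamentalRep (Fin N) ℂ) (continuous_unitaryFundamentalRep (Fin N) ℂ) hd hL
    (by rw [un_variance_re_trace hN]; norm_num)
  refine ⟨s₀, ?_, hz⟩
  rw [un_variance_re_trace hN] at hs₀
  calc ‖s₀‖ ≤ 4 * N / (1 / 2) := hs₀
    _ = 8 * N := by ring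

/-- Lüscher's notation: a zero of `s ↦ ∫ D[U] e^{-sS_W}` with `|s₀| ≤ 8N`, every `L ≥ 2`. [ours] -/
theorem un_wilsonZ_integral_exists_zero_norm_le (hN : 1 ≤ N) (hd : 2 ≤ d) (hL : 2 ≤ L) :
    ∃ s₀ : ℂ, ‖s₀‖ ≤ 8 * N ∧
      ∫ U, cexp (-(s₀ * (wilsonAction (unitaryFundamentalRep (Fin N) ℂ) U : ℂ)))
        ∂(trivialMeasure (Matrix.unitaryGroup (Fin N) ℂ) d L) = 0 := by
  haveI := unitaryGroup_secondCountableTopology (N := N)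
  obtain ⟨s₀, hs₀, hz⟩ := un_wilsonZ_exists_zero_norm_le (d := d) (L := L) hN hd hL
  exact ⟨s₀, hs₀, by
    rw [← WilsonPinching.complexMGF_neg_wilsonAction (unitaryFundamentalRep (Fin N) ℂ) s₀]; exact hz⟩

/-- The closed-form `U(N)` radius: `1/(4e·max(1,2N)·K) = 1/(8e·N·K)` for `N ≥ 1`. [ours] -/
theorem un_kpRadius_eq (hN : 1 ≤ N) (K : ℝ) :
    1 / (4 * Real.exp 1 * max 1 (2 * (N : ℝ)) * K) = 1 / (8 * Real.exp 1 * N * K) := by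
  have hmax : max 1 (2 * (N : ℝ)) = 2 * N := by
    rw [max_eq_right]
    have : (1 : ℝ) ≤ N := by exact_mod_cast hN
    linarith
  rw [hmax]; ring

/-- **`U(N)`: THE FISHER ZEROS ARE EXTENSIVE** — for `N ≥ 1`, every `d`, every `L ≥ 2`, every `R > 0`,
with `r = 1/(8e·N·(3^d d² + 1)²)`: zeros `u` of the `U(N)` Wilson partition function with
`r ≤ |u| < R`, each of multiplicity `≥ 1`, of total multiplicity `≥ r²·(½ − 4N/R)·#plaquettes`. [ours] -/
theorem un_wilsonZ_fisherZeros_extensive (hN : 1 ≤ N) (hL : 2 ≤ L) (R : ℝ) (hR : 0 < R) :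
    ∃ T : Finset ℂ, (∀ u ∈ T,
        complexMGF (fun U => -wilsonAction (unitaryFundamentalRep (Fin N) ℂ) U)
            (trivialMeasure (Matrix.unitaryGroup (Fin N) ℂ) d L) u = 0 ∧
          1 / (8 * Real.exp 1 * N * ((3 : ℝ) ^ d * (d : ℝ) ^ 2 + 1) ^ 2) ≤ ‖u‖ ∧ ‖u‖ < R ∧
          1 ≤ divisor (complexMGF (fun U => -wilsonAction (unitaryFundamentalRep (Fin N) ℂ) U)
            (trivialMeasure (Matrix.unitaryGroup (Fin N) ℂ) d L)) (closedBall (0 : ℂ) (2 * R)) u) ∧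
      (1 / (8 * Real.exp 1 * N * ((3 : ℝ) ^ d * (d : ℝ) ^ 2 + 1) ^ 2)) ^ 2 * (1 / 2 - 4 * N / R) *
          Fintype.card (Plaquette d L) ≤
        ∑ u ∈ T, (divisor (complexMGF (fun U => -wilsonAction (unitaryFundamentalRep (Fin N) ℂ) U)
            (trivialMeasure (Matrix.unitaryGroup (Fin N) ℂ) d L)) (closedBall (0 : ℂ) (2 * R)) u : ℝ) := by
  haveI := unitaryGroup_secondCountableTopology (N := N)
  obtain ⟨T, hT, hsum⟩ := wilsonZ_fisherZeros_extensive_anyGroup (d := d) (L := L)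
    (unitaryFundamentalRep (Fin N) ℂ) (continuous_unitaryFundamentalRep (Fin N) ℂ)
    unitaryFundamentalRep_mem_unitaryGroup hL R hR
  have hr := un_kpRadius_eq hN (((3 : ℝ) ^ d * (d : ℝ) ^ 2 + 1) ^ 2)
  refine ⟨T, fun u hu => ?_, ?_⟩
  · obtain ⟨h1, h2, h3, h4⟩ := hT u hu
    exact ⟨h1, hr ▸ h2, h3, h4⟩
  · rw [un_variance_re_trace hN, hr] at hsum
    exact hsum

/-- **`U(N)` SPECIFIC HEAT AT STRONG COUPLING, UNIFORMLY IN THE VOLUME**: for `N ≥ 1`, every `L ≥ 2` and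
real `|x| < r/4`, `r = 1/(8e·N·(3^d d²+1)²)`:
`|Var_x(S_W^{U(N)}) − #plaq/2| ≤ 256·#plaq·|x|/r³`. [ours] -/
theorem un_variance_sub_le (hN : 1 ≤ N) (hL : 2 ≤ L) (x : ℝ)
    (hx : |x| < 1 / (8 * Real.exp 1 * N * ((3 : ℝ) ^ d * (d : ℝ) ^ 2 + 1) ^ 2) / 4) :
    |variance (wilsonAction (d := d) (L := L) (unitaryFundamentalRep (Fin N) ℂ))
        (wilsonMeasure (d := d) (L := L) (unitaryFundamentalRep (Fin N) ℂ) x) -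
        Fintype.card (Plaquette d L) / 2| ≤
      256 * Fintype.card (Plaquette d L) * |x| /
        (1 / (8 * Real.exp 1 * N * ((3 : ℝ) ^ d * (d : ℝ) ^ 2 + 1) ^ 2)) ^ 3 := by
  haveI := unitaryGroup_secondCountableTopology (N := N)
  have hr := un_kpRadius_eq hN (((3 : ℝ) ^ d * (d : ℝ) ^ 2 + 1) ^ 2)
  have h := wilson_variance_sub_le_anyGroup (d := d) (L := L) (unitaryFundamentalRep (Fin N) ℂ)
    (continuous_unitaryFundamentalRep (Fin N) ℂ) unitaryFundamentalRep_mem_unitaryGroup hL x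
    (by rw [hr]; exact hx)
  rw [un_variance_re_trace hN, hr] at h
  have hhalf : (Fintype.card (Plaquette d L) : ℝ) * (1 / 2) = Fintype.card (Plaquette d L) / 2 := by ring
  rwa [hhalf] at h

/-- **`U(N)`, STRONG COUPLING, EVERY `L ≥ 2`: one exact reweighting step `β → β + δ` (`δ ≥ 0`) with
`[β, β+2δ]` inside the window `|x| ≤ min (r/8) (r³/1024)`, `r = 1/(8e·N·(3^d d²+1)²)`, has importance-
weight second moment `E_{μ_β}[w²] ≥ exp(δ²·#plaq/4)`.** [ours] -/
theorem un_weight_sq_ge_exp (hN : 1 ≤ N) (hL : 2 ≤ L) {β δ : ℝ} (hδ : 0 ≤ δ)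
    (hβ : |β| ≤ min (1 / (8 * Real.exp 1 * N * ((3 : ℝ) ^ d * (d : ℝ) ^ 2 + 1) ^ 2) / 8)
      ((1 / (8 * Real.exp 1 * N * ((3 : ℝ) ^ d * (d : ℝ) ^ 2 + 1) ^ 2)) ^ 3 / 1024))
    (hβ2 : |β + 2 * δ| ≤ min (1 / (8 * Real.exp 1 * N * ((3 : ℝ) ^ d * (d : ℝ) ^ 2 + 1) ^ 2) / 8)
      ((1 / (8 * Real.exp 1 * N * ((3 : ℝ) ^ d * (d : ℝ) ^ 2 + 1) ^ 2)) ^ 3 / 1024)) :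
    Real.exp (δ ^ 2 * (Fintype.card (Plaquette d L) / 4)) ≤
      ∫ U, (Real.exp (-(δ * wilsonAction (unitaryFundamentalRep (Fin N) ℂ) U)) *
        (mgf (fun U => -wilsonAction (unitaryFundamentalRep (Fin N) ℂ) U)
            (trivialMeasure (Matrix.unitaryGroup (Fin N) ℂ) d L) β /
          mgf (fun U => -wilsonAction (unitaryFundamentalRep (Fin N) ℂ) U)
            (trivialMeasure (Matrix.unitaryGroup (Fin N) ℂ) d L) (β + δ))) ^ 2
      ∂(wilsonMeasure (d := d) (L := L) (unitaryFundamentalRep (Fin N) ℂ) β) := by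
  haveI := unitaryGroup_secondCountableTopology (N := N)
  have hr := un_kpRadius_eq hN (((3 : ℝ) ^ d * (d : ℝ) ^ 2 + 1) ^ 2)
  have h1024 : (1 / (8 * Real.exp 1 * N * ((3 : ℝ) ^ d * (d : ℝ) ^ 2 + 1) ^ 2)) ^ 3 / 1024 =
      1 / 2 * (1 / (8 * Real.exp 1 * N * ((3 : ℝ) ^ d * (d : ℝ) ^ 2 + 1) ^ 2)) ^ 3 / 512 := by ring
  have h := wilson_weight_sq_ge_exp_anyGroup (d := d) (L := L) (unitaryFundamentalRep (Fin N) ℂ)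
    (continuous_unitaryFundamentalRep (Fin N) ℂ) unitaryFundamentalRep_mem_unitaryGroup hL hδ
    (by rw [hr, un_variance_re_trace hN, ← h1024]; exact hβ)
    (by rw [hr, un_variance_re_trace hN, ← h1024]; exact hβ2)
  rw [un_variance_re_trace hN] at h
  convert h using 3
  ring

end Wilson

end Summit.Ventures.LatticeQCDFlow.TrivializingMaps
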